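import Literature.LinearAlgebra.Matrix.ExtremalChannels
import HarnessLib

/-!
# Choi's Theorem 5: the extreme points of `CP[𝔐_n, 𝔐_m; K] = {Φ completely positive, Φ(I) = K}` are the maps
# `Φ(A) = Σ_i V_i^* A V_i` with `{V_i^* V_j}_{i,j}` linearly independent (Choi, *Completely positive linear maps on
# complex matrices*, LAA 10 (1975), Theorem 5; proof as in Watrous, *The Theory of Quantum Information*, Theorem 2.31)

Hodge foundations lane (`lit-hodgefound`, prover p24 gen 65 #10; matrix-analysis series, the `Φ(I) = K` twin of
`ExtremalChannels.lean` (#9), whose Lemma 2.30 machinery (`lemma_2_30`, `exists_posSemidef_conj_of_mixture`,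
`eq_zero_of_conjTranspose_rows_mul_mul_rows_eq_zero`, `exists_one_add_sub_smul_posSemidef`) is reused).  THEOREMS
ONLY: no definition, no named fact, net debt 0.  Everything over `ℂ`.

## Source, VERBATIM — M.-D. Choi, Linear Algebra Appl. 10 (1975) 285–290 [Choi1975] (held
`paper:doi-10-1016-0024-3795-75-90075-0`, pp. 287–288)

«For each fixed positive `K` in `𝔐_m`, we write `CP[𝔐_n, 𝔐_m; K] = {Φ : 𝔐_n → 𝔐_m | Φ is completely positive and
Φ(I) = K}`. It is evident that `CP[𝔐_n, 𝔐_m; K]` is a convex set, hence it is the convex hull of its extreme points.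
The following theorem gives a thorough description of the structure of completely positive linear maps.
**THEOREM 5.** Let `Φ : 𝔐_n → 𝔐_m`. Then `Φ` is extreme in `CP[𝔐_n, 𝔐_m; K]` iff `Φ` admits an expression
`Φ(A) = Σ_i V_i^* A V_i` for all `A` in `𝔐_n`, where `V_i` are `n × m` matrices, `Σ_i V_i^*V_i = K`, and
`{V_i^*V_j}_{ij}` is a linearly independent set.»  (Choi's 'only if' proof uses «`Ψ_±(A) = Σ V_i^*AV_i ± Σ λ_ij
V_i^*AV_j`», «`Φ = ½(Ψ_+ + Ψ_−)`», and Remark 4; his 'if' proof expands `W_p = Σ_i α_pi V_i`.  Below both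
directions are proved by the Choi-matrix argument of [Watrous2018, Theorem 2.31] — see `ExtremalChannels.lean` —
with the trace-preservation constraint `Tr_𝒴 J = 𝟙` replaced by `Φ(I) = Tr_𝒳 J(Φ) = K`.)

## Dictionary (no definitions are introduced; as in #9)

* `Φ(A) = Σ_s V_s^* A V_s`, `V : σ → Matrix n m ℂ` linearly independent («canonical expression», Remark 4);
  `R = (of fun s x => V s x.1 x.2 : Matrix σ (n × m) ℂ)`, `J(Φ) = R^*R`.
* `Φ(I)` = `traceLeft J(Φ)` (the partial trace over the INPUT factor of `J(Φ) ∈ L(𝒳 ⊗ 𝒴)`; `traceLeft` of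
  `Literature.Computability.QuantumComplexity`), and `Tr_𝒳(R^*HR) = Σ_{i,j} H(i,j) V_i^*V_j`.
* `CP[𝔐_n, 𝔐_m; K]` with `K = Φ(I)`: completely positive maps `Ψ` (ampliation positivity for all `k`, #1) with
  `Ψ(1) = Φ(1)`; «extreme» spelled out as in #9.

## What is formalized (all PROVED)

`traceLeft_comp`, **`apply_one_eq_traceLeft_choi`** (`Φ(I) = Tr_𝒳 J(Φ)`), **`traceLeft_conjTranspose_rows_mul_mul_rows`**
(`Tr_𝒳(R^*HR) = Σ H(i,j) V_i^*V_j`), `conjTranspose_sum_smul` (the family `{V_i^*V_j}` is closed under adjoints),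
`exists_isHermitian_ne_zero_sum_smul_eq_zero`, **`theorem_5_if`**, **`theorem_5_only_if`** (explicit
`Ψ_+ ≠ Ψ_−` in `CP[K]` with `Φ = ½(Ψ_+ + Ψ_−)`), **`theorem_5`** (the iff).
-/

open Matrix
open scoped ComplexOrder MatrixOrder

namespace Literature.LinearAlgebra.Matrix.ExtremalCompletelyPositiveMaps

open Literature.Computability.QuantumComplexity (traceLeft traceLeft_apply)
open Literature.LinearAlgebra.Matrix.ChoiTheoremCompletelyPositiveMaps (choi_theorem_2 apply_eq_sum_smul_apply_single)
open Literature.LinearAlgebra.Matrix.ChoiRankKrausRepresentations (kraus₂_iff_choi_eq)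
open Literature.LinearAlgebra.Matrix.JordanHahnHermitianPreservingMaps (choi_add choi_smul exists_linearMap_choi_eq
  eq_of_choi_eq)
open Literature.LinearAlgebra.Matrix.ExtremalChannels (exists_posSemidef_conj_of_mixture
  eq_zero_of_conjTranspose_rows_mul_mul_rows_eq_zero exists_one_add_sub_smul_posSemidef)

variable {n m σ : Type*} [Fintype n] [Fintype m] [Fintype σ] [DecidableEq n] [DecidableEq m] [DecidableEq σ]

/-! ## § 1 `Φ(I) = Tr_𝒳 J(Φ)` and `Tr_𝒳(R^*HR) = Σ_{i,j} H(i,j) V_i^*V_j` -/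

section Traces

omit [Fintype m] [DecidableEq n] [DecidableEq m] [DecidableEq σ] [Fintype σ] in
/-- The partial trace over the input factor of a block matrix: `Tr_𝒳 (B_jk)_{j,k} = Σ_j B_jj`. [folklore] -/
private theorem traceLeft_comp (B : Matrix n n (Matrix m m ℂ)) : traceLeft (comp n n m m ℂ B) = ∑ j, B j j := by
  ext a b
  simp only [traceLeft_apply, comp_apply, Matrix.sum_apply]

omit [Fintype m] [DecidableEq m] [DecidableEq σ] [Fintype σ] in
/-- **`Φ(I) = Σ_j Φ(E_jj) = Tr_𝒳 J(Φ)`.** [cite: Choi1975, Theorem 5 (the constraint `Φ(I) = K`)]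
[cite: Watrous2018, §2.2.1 (2.66)] -/
theorem apply_one_eq_traceLeft_choi (Φ : Matrix n n ℂ →ₗ[ℂ] Matrix m m ℂ) :
    Φ 1 = traceLeft (comp n n m m ℂ (of fun j k => Φ (single j k 1))) := by
  rw [traceLeft_comp, apply_eq_sum_smul_apply_single Φ 1]
  refine Finset.sum_congr rfl fun j _ => ?_
  simp only [Matrix.one_apply, ite_smul, one_smul, zero_smul, Finset.sum_ite_eq, Finset.mem_univ, if_true, of_apply]

omit [Fintype m] [DecidableEq n] [DecidableEq m] [DecidableEq σ] in
/-- **`Tr_𝒳(R^*HR) = Σ_{i,j} H(i,j) V_i^*V_j`** (the `Φ(I) = K` counterpart of (2.182)). [cite: Choi1975, Theorem 5 (proof)]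
[cite: Watrous2018, Theorem 2.31 (proof, (2.182))] -/
theorem traceLeft_conjTranspose_rows_mul_mul_rows (V : σ → Matrix n m ℂ) (H : Matrix σ σ ℂ) :
    traceLeft ((of fun s (x : n × m) => V s x.1 x.2 : Matrix σ (n × m) ℂ)ᴴ * H *
      (of fun s (x : n × m) => V s x.1 x.2 : Matrix σ (n × m) ℂ)) = ∑ s, ∑ t, H s t • ((V s)ᴴ * V t) := by
  ext a b
  simp only [traceLeft_apply, Matrix.sum_apply, Matrix.smul_apply, smul_eq_mul, Matrix.mul_apply,
    conjTranspose_apply, of_apply, Finset.sum_mul, Finset.mul_sum]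
  calc ∑ j, ∑ t, ∑ s, star (V s j a) * H s t * V t j b
      = ∑ j, ∑ s, ∑ t, star (V s j a) * H s t * V t j b := Finset.sum_congr rfl fun j _ => Finset.sum_comm
    _ = ∑ s, ∑ j, ∑ t, star (V s j a) * H s t * V t j b := Finset.sum_comm
    _ = ∑ s, ∑ t, ∑ j, star (V s j a) * H s t * V t j b := Finset.sum_congr rfl fun s _ => Finset.sum_comm
    _ = ∑ s, ∑ t, ∑ j, H s t * (star (V s j a) * V t j b) := by
        refine Finset.sum_congr rfl fun s _ => Finset.sum_congr rfl fun t _ => Finset.sum_congr rfl fun j _ => ?_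
        ring

omit [Fintype m] [DecidableEq n] [DecidableEq m] [DecidableEq σ] in
/-- `Tr_𝒳` is additive. [folklore] -/
private theorem traceLeft_add' (A B : Matrix (n × m) (n × m) ℂ) :
    traceLeft (A + B) = traceLeft A + traceLeft B := by
  ext a b
  simp only [traceLeft_apply, Matrix.add_apply, Finset.sum_add_distrib]

omit [Fintype m] [DecidableEq n] [DecidableEq m] [DecidableEq σ] in
/-- `Tr_𝒳` respects subtraction. [folklore] -/
private theorem traceLeft_sub' (A B : Matrix (n × m) (n × m) ℂ) :
    traceLeft (A - B) = traceLeft A - traceLeft B := by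
  ext a b
  simp only [traceLeft_apply, Matrix.sub_apply, Finset.sum_sub_distrib]

omit [Fintype m] [DecidableEq n] [DecidableEq m] [DecidableEq σ] in
/-- Linear independence of `{V_i^*V_j}` kills the coefficients of a vanishing combination. [folklore] -/
private theorem eq_zero_of_sum_smul_eq_zero (V : σ → Matrix n m ℂ)
    (hind : LinearIndependent ℂ fun st : σ × σ => (V st.1)ᴴ * V st.2) {H : Matrix σ σ ℂ}
    (h : ∑ s, ∑ t, H s t • ((V s)ᴴ * V t) = 0) : H = 0 := by
  have h' : ∑ st : σ × σ, H st.1 st.2 • ((V st.1)ᴴ * V st.2) = 0 := by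
    rw [Fintype.sum_prod_type]
    exact h
  ext s t
  exact Fintype.linearIndependent_iff.mp hind (fun st => H st.1 st.2) h' (s, t)

omit [Fintype m] [DecidableEq n] [DecidableEq m] [DecidableEq σ] in
/-- `(Σ_{i,j} H(i,j) V_i^*V_j)^* = Σ_{i,j} H^*(i,j) V_i^*V_j` («from `Σ λ_ij V_i^*V_j = 0` we infer that
`Σ (λ_ij + λ̄_ji) V_i^*V_j = 0`»). [cite: Choi1975, Theorem 5 (proof)] -/
theorem conjTranspose_sum_smul (V : σ → Matrix n m ℂ) (H : Matrix σ σ ℂ) :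
    (∑ s, ∑ t, H s t • ((V s)ᴴ * V t))ᴴ = ∑ s, ∑ t, Hᴴ s t • ((V s)ᴴ * V t) := by
  simp only [conjTranspose_sum, conjTranspose_smul, conjTranspose_mul, conjTranspose_conjTranspose,
    conjTranspose_apply]
  exact Finset.sum_comm

omit [Fintype m] [Fintype σ] [DecidableEq n] [DecidableEq m] [DecidableEq σ] in
/-- Additivity of `H ↦ Σ H(i,j) V_i^*V_j`. [folklore] -/
private theorem sum_smul_add [Fintype σ] (V : σ → Matrix n m ℂ) (H K : Matrix σ σ ℂ) :
    ∑ s, ∑ t, (H + K) s t • ((V s)ᴴ * V t) =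
      ∑ s, ∑ t, H s t • ((V s)ᴴ * V t) + ∑ s, ∑ t, K s t • ((V s)ᴴ * V t) := by
  simp only [Matrix.add_apply, add_smul, Finset.sum_add_distrib]

omit [Fintype m] [Fintype σ] [DecidableEq n] [DecidableEq m] [DecidableEq σ] in
/-- `H ↦ Σ H(i,j) V_i^*V_j` respects subtraction. [folklore] -/
private theorem sum_smul_sub [Fintype σ] (V : σ → Matrix n m ℂ) (H K : Matrix σ σ ℂ) :
    ∑ s, ∑ t, (H - K) s t • ((V s)ᴴ * V t) =
      ∑ s, ∑ t, H s t • ((V s)ᴴ * V t) - ∑ s, ∑ t, K s t • ((V s)ᴴ * V t) := by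
  simp only [Matrix.sub_apply, sub_smul, Finset.sum_sub_distrib]

omit [Fintype m] [Fintype σ] [DecidableEq n] [DecidableEq m] [DecidableEq σ] in
/-- Homogeneity of `H ↦ Σ H(i,j) V_i^*V_j`. [folklore] -/
private theorem sum_smul_smul [Fintype σ] (V : σ → Matrix n m ℂ) (c : ℂ) (H : Matrix σ σ ℂ) :
    ∑ s, ∑ t, (c • H) s t • ((V s)ᴴ * V t) = c • ∑ s, ∑ t, H s t • ((V s)ᴴ * V t) := by
  simp only [Matrix.smul_apply, smul_eq_mul, mul_smul, Finset.smul_sum]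

omit [Fintype m] [DecidableEq n] [DecidableEq m] [DecidableEq σ] in
/-- **«We may assume that `(λ_ij)_ij` is a hermitian matrix»**: a nonzero `Z` with `Σ Z(i,j) V_i^*V_j = 0` yields a
nonzero Hermitian `H` with `Σ H(i,j) V_i^*V_j = 0`. [cite: Choi1975, Theorem 5 (proof)]
[cite: Watrous2018, Theorem 2.31 (proof, (2.187))] -/
theorem exists_isHermitian_ne_zero_sum_smul_eq_zero (V : σ → Matrix n m ℂ) {Z : Matrix σ σ ℂ} (hZ0 : Z ≠ 0)
    (hZ : ∑ s, ∑ t, Z s t • ((V s)ᴴ * V t) = 0) :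
    ∃ H : Matrix σ σ ℂ, H.IsHermitian ∧ H ≠ 0 ∧ ∑ s, ∑ t, H s t • ((V s)ᴴ * V t) = 0 := by
  have hZs : ∑ s, ∑ t, Zᴴ s t • ((V s)ᴴ * V t) = 0 := by
    rw [← conjTranspose_sum_smul, hZ, conjTranspose_zero]
  have h1 : (Z + Zᴴ).IsHermitian := isHermitian_add_transpose_self Z
  have h2 : (Complex.I • (Z - Zᴴ)).IsHermitian := by
    change (Complex.I • (Z - Zᴴ))ᴴ = Complex.I • (Z - Zᴴ)
    rw [conjTranspose_smul, conjTranspose_sub, conjTranspose_conjTranspose, Complex.star_def, Complex.conj_I,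
      neg_smul, ← smul_neg, neg_sub]
  have r1 : ∑ s, ∑ t, (Z + Zᴴ) s t • ((V s)ᴴ * V t) = 0 := by rw [sum_smul_add, hZ, hZs, add_zero]
  have r2 : ∑ s, ∑ t, (Complex.I • (Z - Zᴴ)) s t • ((V s)ᴴ * V t) = 0 := by
    rw [sum_smul_smul, sum_smul_sub, hZ, hZs, sub_zero, smul_zero]
  by_cases hH1 : Z + Zᴴ = 0
  · refine ⟨Complex.I • (Z - Zᴴ), h2, ?_, r2⟩
    intro h0
    have hZZ : Z - Zᴴ = 0 := by
      rcases smul_eq_zero.mp h0 with h | h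
      · exact absurd h Complex.I_ne_zero
      · exact h
    apply hZ0
    have : (2 : ℂ) • Z = 0 := by
      rw [two_smul]
      calc Z + Z = (Z + Zᴴ) + (Z - Zᴴ) := by abel
        _ = 0 := by rw [hH1, hZZ, add_zero]
    rcases smul_eq_zero.mp this with h | h
    · exact absurd h two_ne_zero
    · exact h
  · exact ⟨Z + Zᴴ, h1, hH1, r1⟩

end Traces

/-! ## § 2 Theorem 5 -/

section Theorem5

/-- **Theorem 5, «if»: if `Φ(A) = Σ_i V_i^*AV_i` with `{V_i}` and `{V_i^*V_j}_{ij}` linearly independent, then `Φ` is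
extreme in `CP[𝔐_n, 𝔐_m; Φ(I)]`** — completely positive `Ψ_0, Ψ_1` with `Ψ_i(I) = Φ(I)` and
`Φ = λΨ_0 + (1−λ)Ψ_1`, `λ ∈ (0,1)`, coincide.  (Watrous' argument: `J(Ψ_i) = R^*T_iR` by Lemma 2.30 and
`Tr_𝒳(R^*(T_0 − T_1)R) = Σ (T_0−T_1)(i,j)V_i^*V_j = Ψ_0(I) − Ψ_1(I) = 0`.) [cite: Choi1975, Theorem 5]
[cite: Watrous2018, Theorem 2.31] -/
theorem theorem_5_if (Φ Ψ₀ Ψ₁ : Matrix n n ℂ →ₗ[ℂ] Matrix m m ℂ) (V : σ → Matrix n m ℂ)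
    (hΦ : ∀ X, Φ X = ∑ s, (V s)ᴴ * X * V s) (hV : LinearIndependent ℂ V)
    (hind : LinearIndependent ℂ fun st : σ × σ => (V st.1)ᴴ * V st.2)
    (h₀ : ∀ (k : ℕ) (X : Matrix (Fin k × n) (Fin k × n) ℂ), X.PosSemidef →
      (comp (Fin k) (Fin k) m m ℂ (((comp (Fin k) (Fin k) n n ℂ).symm X).map Ψ₀)).PosSemidef)
    (h₀' : Ψ₀ 1 = Φ 1)
    (h₁ : ∀ (k : ℕ) (X : Matrix (Fin k × n) (Fin k × n) ℂ), X.PosSemidef →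
      (comp (Fin k) (Fin k) m m ℂ (((comp (Fin k) (Fin k) n n ℂ).symm X).map Ψ₁)).PosSemidef)
    (h₁' : Ψ₁ 1 = Φ 1)
    {l : ℝ} (hl₀ : 0 < l) (hl₁ : l < 1) (hmix : Φ = (l : ℂ) • Ψ₀ + ((1 - l : ℝ) : ℂ) • Ψ₁) : Ψ₀ = Ψ₁ := by
  set R := (of fun s (x : n × m) => V s x.1 x.2 : Matrix σ (n × m) ℂ) with hR
  have hP : comp n n m m ℂ (of fun j k => Φ (single j k 1)) = Rᴴ * R := (kraus₂_iff_choi_eq Φ V V).mp hΦ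
  have hQ₀ := (choi_theorem_2 Ψ₀).mp h₀
  have hQ₁ := (choi_theorem_2 Ψ₁).mp h₁
  have hPmix : Rᴴ * R = (l : ℂ) • comp n n m m ℂ (of fun j k => Ψ₀ (single j k 1)) +
      ((1 - l : ℝ) : ℂ) • comp n n m m ℂ (of fun j k => Ψ₁ (single j k 1)) := by
    rw [← hP, hmix, choi_add, choi_smul, choi_smul]
  have hPmix' : Rᴴ * R = ((1 - l : ℝ) : ℂ) • comp n n m m ℂ (of fun j k => Ψ₁ (single j k 1)) +
      (l : ℂ) • comp n n m m ℂ (of fun j k => Ψ₀ (single j k 1)) := by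
    rw [hPmix, add_comm]
  obtain ⟨T₀, -, hT₀⟩ := exists_posSemidef_conj_of_mixture V hV hQ₀ hQ₁ hl₀ (sub_nonneg.mpr hl₁.le) hPmix
  obtain ⟨T₁, -, hT₁⟩ := exists_posSemidef_conj_of_mixture V hV hQ₁ hQ₀ (sub_pos.mpr hl₁) hl₀.le hPmix'
  have ht₀ := apply_one_eq_traceLeft_choi Ψ₀
  have ht₁ := apply_one_eq_traceLeft_choi Ψ₁
  have hH : traceLeft (Rᴴ * (T₀ - T₁) * R) = 0 := by
    rw [Matrix.mul_sub, Matrix.sub_mul, traceLeft_sub', ← hT₀, ← hT₁, ← ht₀, ← ht₁, h₀', h₁', sub_self]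
  rw [traceLeft_conjTranspose_rows_mul_mul_rows] at hH
  have hT : T₀ = T₁ := sub_eq_zero.mp (eq_zero_of_sum_smul_eq_zero V hind hH)
  refine eq_of_choi_eq Ψ₀ Ψ₁ ?_
  rw [hT₀, hT₁, hT]

/-- **Theorem 5, «only if»: if `Φ(A) = Σ_i V_i^*AV_i` with `{V_i}` linearly independent but `{V_i^*V_j}_{ij}` linearly
DEPENDENT, then `Φ` is not extreme in `CP[𝔐_n, 𝔐_m; Φ(I)]`: `Φ = ½(Ψ_+ + Ψ_−)` for completely positive
`Ψ_± ≠` each other with `Ψ_±(I) = Φ(I)`** (`J(Ψ_±) = R^*(𝟙 ± H)R` for a suitable nonzero Hermitian `H` with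
`Σ H(i,j)V_i^*V_j = 0`; Choi writes `Ψ_±(A) = Σ V_i^*AV_i ± Σ λ_ij V_i^*AV_j`). [cite: Choi1975, Theorem 5]
[cite: Watrous2018, Theorem 2.31] -/
theorem theorem_5_only_if (Φ : Matrix n n ℂ →ₗ[ℂ] Matrix m m ℂ) (V : σ → Matrix n m ℂ)
    (hΦ : ∀ X, Φ X = ∑ s, (V s)ᴴ * X * V s) (hV : LinearIndependent ℂ V)
    (hdep : ¬ LinearIndependent ℂ fun st : σ × σ => (V st.1)ᴴ * V st.2) :
    ∃ Ψ₀ Ψ₁ : Matrix n n ℂ →ₗ[ℂ] Matrix m m ℂ,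
      (∀ (k : ℕ) (X : Matrix (Fin k × n) (Fin k × n) ℂ), X.PosSemidef →
        (comp (Fin k) (Fin k) m m ℂ (((comp (Fin k) (Fin k) n n ℂ).symm X).map Ψ₀)).PosSemidef) ∧
      Ψ₀ 1 = Φ 1 ∧
      (∀ (k : ℕ) (X : Matrix (Fin k × n) (Fin k × n) ℂ), X.PosSemidef →
        (comp (Fin k) (Fin k) m m ℂ (((comp (Fin k) (Fin k) n n ℂ).symm X).map Ψ₁)).PosSemidef) ∧
      Ψ₁ 1 = Φ 1 ∧ Ψ₀ ≠ Ψ₁ ∧ Φ = (2⁻¹ : ℂ) • (Ψ₀ + Ψ₁) := by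
  set R := (of fun s (x : n × m) => V s x.1 x.2 : Matrix σ (n × m) ℂ) with hR
  have hP : comp n n m m ℂ (of fun j k => Φ (single j k 1)) = Rᴴ * R := (kraus₂_iff_choi_eq Φ V V).mp hΦ
  have htP : Φ 1 = traceLeft (Rᴴ * R) := by rw [← hP]; exact apply_one_eq_traceLeft_choi Φ
  obtain ⟨g, hg, st₀, hg₀⟩ := Fintype.not_linearIndependent_iff.mp hdep
  have hZ : ∑ s, ∑ t, (of fun s t => g (s, t) : Matrix σ σ ℂ) s t • ((V s)ᴴ * V t) = 0 := by
    rw [← hg, Fintype.sum_prod_type]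
    rfl
  have hZ0 : (of fun s t => g (s, t) : Matrix σ σ ℂ) ≠ 0 := fun h =>
    hg₀ (by simpa only [of_apply, Matrix.zero_apply] using congr_fun (congr_fun h st₀.1) st₀.2)
  obtain ⟨H₀, hH₀h, hH₀0, hH₀r⟩ := exists_isHermitian_ne_zero_sum_smul_eq_zero V hZ0 hZ
  obtain ⟨c, hc0, hplus, hminus⟩ := exists_one_add_sub_smul_posSemidef hH₀h hH₀0
  have hHr : ∑ s, ∑ t, (c • H₀) s t • ((V s)ᴴ * V t) = 0 := by rw [sum_smul_smul, hH₀r, smul_zero]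
  have hH0 : c • H₀ ≠ 0 := fun h => by
    rcases smul_eq_zero.mp h with h' | h'
    · exact hc0 h'
    · exact hH₀0 h'
  have htH : traceLeft (Rᴴ * (c • H₀) * R) = 0 := by
    rw [traceLeft_conjTranspose_rows_mul_mul_rows, hHr]
  obtain ⟨Ψ₀, hΨ₀⟩ := exists_linearMap_choi_eq (n := n) (m := m) (Rᴴ * (1 + c • H₀) * R)
  obtain ⟨Ψ₁, hΨ₁⟩ := exists_linearMap_choi_eq (n := n) (m := m) (Rᴴ * (1 - c • H₀) * R)
  have hJ₀ : (Rᴴ * (1 + c • H₀) * R).PosSemidef := hplus.conjTranspose_mul_mul_same R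
  have hJ₁ : (Rᴴ * (1 - c • H₀) * R).PosSemidef := hminus.conjTranspose_mul_mul_same R
  refine ⟨Ψ₀, Ψ₁, (choi_theorem_2 Ψ₀).mpr (by rw [hΨ₀]; exact hJ₀), ?_,
    (choi_theorem_2 Ψ₁).mpr (by rw [hΨ₁]; exact hJ₁), ?_, ?_, ?_⟩
  · rw [apply_one_eq_traceLeft_choi, hΨ₀, Matrix.mul_add, Matrix.add_mul, Matrix.mul_one, traceLeft_add', htH,
      add_zero, htP]
  · rw [apply_one_eq_traceLeft_choi, hΨ₁, Matrix.mul_sub, Matrix.sub_mul, Matrix.mul_one, traceLeft_sub', htH,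
      sub_zero, htP]
  · intro heq
    apply hH0
    have hJ : Rᴴ * (1 + c • H₀) * R = Rᴴ * (1 - c • H₀) * R := by rw [← hΨ₀, ← hΨ₁, heq]
    have h2 : Rᴴ * ((2 : ℂ) • (c • H₀)) * R = 0 := by
      rw [two_smul, Matrix.mul_add, Matrix.add_mul]
      have e : Rᴴ * (1 + c • H₀) * R - Rᴴ * (1 - c • H₀) * R = Rᴴ * (c • H₀) * R + Rᴴ * (c • H₀) * R := by
        rw [Matrix.mul_add, Matrix.add_mul, Matrix.mul_sub, Matrix.sub_mul]
        abel
      rw [← e, hJ, sub_self]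
    have h3 := eq_zero_of_conjTranspose_rows_mul_mul_rows_eq_zero V hV h2
    rcases smul_eq_zero.mp h3 with h | h
    · exact absurd h two_ne_zero
    · exact h
  · refine eq_of_choi_eq _ _ ?_
    rw [hP, choi_smul, choi_add, hΨ₀, hΨ₁]
    rw [Matrix.mul_add, Matrix.add_mul, Matrix.mul_sub, Matrix.sub_mul, Matrix.mul_one, add_add_sub_cancel,
      ← two_smul ℂ, smul_smul, inv_mul_cancel₀ (two_ne_zero : (2 : ℂ) ≠ 0), one_smul]

/-- **THEOREM 5 (Choi): a completely positive `Φ(A) = Σ_i V_i^*AV_i` with `{V_i}` linearly independent is extreme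
in `CP[𝔐_n, 𝔐_m; K]`, `K = Φ(I)`, iff `{V_i^*V_j}_{ij}` is linearly independent** (extreme point spelled out: every
decomposition `Φ = λΨ_0 + (1−λ)Ψ_1`, `λ ∈ (0,1)`, into completely positive `Ψ_i` with `Ψ_i(I) = K` is trivial).
[cite: Choi1975, Theorem 5] [cite: Watrous2018, Theorem 2.31] -/
theorem theorem_5 (Φ : Matrix n n ℂ →ₗ[ℂ] Matrix m m ℂ) (V : σ → Matrix n m ℂ)
    (hΦ : ∀ X, Φ X = ∑ s, (V s)ᴴ * X * V s) (hV : LinearIndependent ℂ V) :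
    (∀ (Ψ₀ Ψ₁ : Matrix n n ℂ →ₗ[ℂ] Matrix m m ℂ) (l : ℝ),
      (∀ (k : ℕ) (X : Matrix (Fin k × n) (Fin k × n) ℂ), X.PosSemidef →
        (comp (Fin k) (Fin k) m m ℂ (((comp (Fin k) (Fin k) n n ℂ).symm X).map Ψ₀)).PosSemidef) →
      Ψ₀ 1 = Φ 1 →
      (∀ (k : ℕ) (X : Matrix (Fin k × n) (Fin k × n) ℂ), X.PosSemidef →
        (comp (Fin k) (Fin k) m m ℂ (((comp (Fin k) (Fin k) n n ℂ).symm X).map Ψ₁)).PosSemidef) →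
      Ψ₁ 1 = Φ 1 →
      0 < l → l < 1 → Φ = (l : ℂ) • Ψ₀ + ((1 - l : ℝ) : ℂ) • Ψ₁ → Ψ₀ = Ψ₁) ↔
    LinearIndependent ℂ fun st : σ × σ => (V st.1)ᴴ * V st.2 := by
  constructor
  · intro hext
    by_contra hdep
    obtain ⟨Ψ₀, Ψ₁, h₀, h₀', h₁, h₁', hne, hmix⟩ := theorem_5_only_if Φ V hΦ hV hdep
    refine hne (hext Ψ₀ Ψ₁ (1 / 2) h₀ h₀' h₁ h₁' one_half_pos one_half_lt_one ?_)
    rw [hmix, smul_add]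
    congr 1 <;> push_cast <;> norm_num
  · intro hind Ψ₀ Ψ₁ l h₀ h₀' h₁ h₁' hl₀ hl₁ hmix
    exact theorem_5_if Φ Ψ₀ Ψ₁ V hΦ hV hind h₀ h₀' h₁ h₁' hl₀ hl₁ hmix

end Theorem5

end Literature.LinearAlgebra.Matrix.ExtremalCompletelyPositiveMaps
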